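import Mathlib
import Summits.ValiantsHypothesis.ValiantsHypothesis.Theorems.GrenetZeonTwoDimCoefficientsScalingKoenigHessianRank

/-!
# Crux `GrenetZeon.TwoDimCoefficients` (stmt-ValiantsHypothesis-8062) / rung `DualUnipotentThreeHalves` (stmt-24318):
# scaling-closure — HESSIAN RANK OF POLYNOMIALS THAT ARE LINEAR OFF A SMALL VARIABLE SET (garbage is cheap in Hessian currency)

Tool for the «mass cut in Hessian currency» (memo NINETEENTH-HAND.md §10): a matrix whose entries vanish off the rows and columns
indexed by a set `S` has rank `≤ 2|S|`; hence a polynomial all of whose second partials `∂_c ∂_{c'}` with `c, c' ∉ S` vanish — e.g.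
`f = Σ_c X_c·P_c(X_S) + P₀(X_S)`, the trace contribution `tr(G^{n−1} B′)` of a garbage constituent `G` supported on the variables `S`
— has `rank Hess f ≤ 2|S|` at EVERY point.  With the per-free Hessian-rate law (✓ p835784) for index-`n` constituents and
subadditivity of the rank this prices block-diagonal garbage additively: `n² ≤ Σ_i 2m_i²/n + Σ_j 2|S_j|`.

* ★ `rank_le_two_mul_card_of_support` — `(∀ i j, i ∉ S → j ∉ S → H i j = 0) ⇒ rank H ≤ 2|S|`;
* ★ `rank_hess0_transl_le_of_pderiv_pderiv_eq_zero` — `(∀ c c' ∉ S, ∂_c ∂_{c'} f = 0) ⇒ rank Hess f (z) ≤ 2|S|` for all `z`.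

HONEST FRAMING: unconditional infrastructure; proves no rung: the stub `DualUnipotentBound`, crux 8062, the 24318 decl and `VP ≠ VNP`
remain open.

References: folklore linear algebra; T. Mignon, N. Ressayre, Int. Math. Res. Not. 2004:79 (Hessian method, via the tree).
-/

-- single-conjunct layout `Summits/ValiantsHypothesis/ValiantsHypothesis`: the duplicated namespace
-- component is mandated by the tree.
set_option linter.dupNamespace false
set_option autoImplicit false

noncomputable section

namespace Summit.ValiantsHypothesis.ValiantsHypothesis.Theorems.GrenetZeonTwoDimCoefficients.ScalingClosure

open MvPolynomial Matrix
open Literature.Computability.AlgebraicComplexity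

section SupportRank

variable {ι : Type*} [Fintype ι] [DecidableEq ι]

/-- ★ **Support bound**: a square matrix whose entries vanish off the rows and columns indexed by `S` has rank `≤ 2|S|`
(`H = D H + (1 − D) H D` with `D` the diagonal indicator of `S`). [folklore] -/
theorem rank_le_two_mul_card_of_support (H : Matrix ι ι ℂ) (S : Finset ι)
    (hH : ∀ i j, i ∉ S → j ∉ S → H i j = 0) : H.rank ≤ 2 * S.card := by
  classical
  set D : Matrix ι ι ℂ := Matrix.diagonal (fun s => if s ∈ S then (1 : ℂ) else 0) with hD
  have hdec : H = D * H + (1 - D) * H * D := by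
    ext i j
    rw [Matrix.add_apply, Matrix.mul_diagonal, Matrix.sub_mul, Matrix.one_mul, Matrix.sub_apply,
      Matrix.diagonal_mul]
    by_cases hi : i ∈ S
    · rw [if_pos hi, one_mul, sub_self, zero_mul, add_zero]
    · rw [if_neg hi, zero_mul, zero_add, sub_zero]
      by_cases hj : j ∈ S
      · rw [if_pos hj, mul_one]
      · rw [if_neg hj, mul_zero, hH i j hi hj]
  have hDrank : D.rank ≤ S.card := by
    rw [hD, Matrix.rank_diagonal]
    have hcard : Fintype.card {s : ι // (if s ∈ S then (1 : ℂ) else 0) ≠ 0} = S.card := by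
      have e : {s : ι // (if s ∈ S then (1 : ℂ) else 0) ≠ 0} ≃ {s : ι // s ∈ S} :=
        Equiv.subtypeEquiv (Equiv.refl _) (fun s => by
          change ((if s ∈ S then (1 : ℂ) else 0) ≠ 0) ↔ s ∈ S
          by_cases h : s ∈ S
          · simp [h]
          · simp [h])
      rw [Fintype.card_congr e, Fintype.card_coe]
    omega
  have hadd : ∀ A' B' : Matrix ι ι ℂ, (A' + B').rank ≤ A'.rank + B'.rank := by
    intro A' B'
    unfold Matrix.rank
    rw [Matrix.mulVecLin_add]
    calc Module.finrank ℂ (LinearMap.range (A'.mulVecLin + B'.mulVecLin))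
        ≤ Module.finrank ℂ ↥(LinearMap.range A'.mulVecLin ⊔ LinearMap.range B'.mulVecLin) := by
          apply Submodule.finrank_mono
          rintro _ ⟨v, rfl⟩
          exact Submodule.add_mem_sup ⟨v, rfl⟩ ⟨v, rfl⟩
      _ ≤ _ := Submodule.finrank_add_le_finrank_add_finrank _ _
  calc H.rank = (D * H + (1 - D) * H * D).rank := by rw [← hdec]
    _ ≤ (D * H).rank + ((1 - D) * H * D).rank := hadd _ _
    _ ≤ D.rank + D.rank := add_le_add (Matrix.rank_mul_le_left _ _) (Matrix.rank_mul_le_right _ _)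
    _ ≤ 2 * S.card := by omega

/-- ★ **Polynomials that are linear off `S` have Hessian rank `≤ 2|S|` everywhere**: if `∂_c ∂_{c'} f = 0` for all `c, c' ∉ S`
(e.g. `f = Σ_c X_c·P_c(X_S) + P₀(X_S)`), then `rank Hess f (z) ≤ 2|S|` at every point `z`. [folklore] -/
theorem rank_hess0_transl_le_of_pderiv_pderiv_eq_zero (f : MvPolynomial ι ℂ) (S : Finset ι)
    (hf : ∀ c c', c ∉ S → c' ∉ S → pderiv c (pderiv c' f) = 0) (z : ι → ℂ) :
    (hess0 (transl z f)).rank ≤ 2 * S.card := by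
  refine rank_le_two_mul_card_of_support _ S fun i j hi hj => ?_
  rw [hess0_transl, hf i j hi hj, map_zero]

end SupportRank

end Summit.ValiantsHypothesis.ValiantsHypothesis.Theorems.GrenetZeonTwoDimCoefficients.ScalingClosure

end
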